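import Summits.AtomisticToContinuum.Crystallization.Theorems.ExcessDecayLiouvillePhononStabilityCertNear
import Summits.AtomisticToContinuum.Crystallization.Theorems.ExcessDecayLiouvillePhononStabilityCertCharge
import Summits.AtomisticToContinuum.Crystallization.Theorems.ExcessDecayLiouvillePhononStabilityCertCover
import Summits.AtomisticToContinuum.Crystallization.Theorems.ExcessDecayLiouvillePhononStabilityCertRangeSum

/-!
# Near-certificate layer XIII: cells, their checks, and the assembly of `NearCertificate`
Support file for crux `PhononStability` (stmt-AtomisticToContinuum-9333), line `contragredient-window-collapse`
(lead c2).  A CELL is raw rational data (`CellPack`); Lean ASSEMBLES its `CellCert` and its target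
`cellTarget = nearPPF ++ chargePPF ++ farN0PPF`; `cellOK` is ONE Boolean (native) check per cell; `cell_sound`
turns it into the `NearCertificate` inequality on the cell's free box; `nearCertificate_of_cells` assembles
finitely many cells covering the root box. [folklore]
-/

noncomputable section

open scoped BigOperators Classical InnerProductSpace
open Filter Set Function
open Summit.AtomisticToContinuum.Crystallization.Theorems.PhononStabilityNegative
open Summit.AtomisticToContinuum.Crystallization.Theorems.PhononStabilityCWC.FarControlStub

namespace Summit.AtomisticToContinuum.Crystallization.Theorems.PhononStabilityCWC.Cert

local notation "E3" => EuclideanSpace ℝ (Fin 3)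

/-- parse a natural number from digit characters, accumulating -/
def parseNatAux : List Char → ℕ → ℕ
  | [], acc => acc
  | c :: cs, acc => parseNatAux cs (acc * 10 + (c.toNat - '0'.toNat))

/-- parse an integer token (optional leading `-`) -/
def parseIntTok (s : String) : ℤ :=
  match s.toList with
  | '-' :: cs => -((parseNatAux cs 0 : ℕ) : ℤ)
  | cs => ((parseNatAux cs 0 : ℕ) : ℤ)

/-- parse a rational token `a/b` or `a` -/
def parseRatTok (s : String) : ℚ :=
  match s.splitOn "/" with
  | [a, b] => (parseIntTok a : ℚ) / (parseIntTok b : ℚ)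
  | [a] => (parseIntTok a : ℚ)
  | _ => 0

/-- parse rows separated by `|`, entries separated by spaces; every entry is divided by the common denominator `den` -/
def parseRows (den : ℕ) (s : String) : Array (Array ℚ) :=
  ((s.splitOn "|").map fun row =>
    (((row.splitOn " ").filter (· ≠ "")).map fun t => parseRatTok t / (den : ℚ)).toArray).toArray

/-- parse one row (space-separated) with common denominator -/
def parseRow (den : ℕ) (s : String) : Array ℚ :=
  (((s.splitOn " ").filter (· ≠ "")).map fun t => parseRatTok t / (den : ℚ)).toArray

/-- specification of a window multiplier polynomial (nonnegative on the cell ∩ window) -/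
inductive WinSpec where
  /-- a univariate polynomial `p(x_v)` checked nonnegative on `|x_v| ≤ hbox v` -/
  | ubrick (v : ℕ) (p : UPoly)
  /-- lower strain window `vᵀ Ĝ v − a² ‖Σ vᵢ genᵢ‖² ≥ 0` for a rational vector `v` -/
  | strainLo (v : Fin 3 → ℚ)
  /-- upper strain window `b² ‖Σ vᵢ genᵢ‖² − vᵀ Ĝ v ≥ 0` -/
  | strainHi (v : Fin 3 → ℚ)
  /-- shift window `1/1600 − δ̂ᵀ Ĝ δ̂ ≥ 0` -/
  | shiftWin
  /-- a product of two specifications -/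
  | mul (s t : WinSpec)

/-- `vᵀ Ĝ v` as a polynomial: `vᵀ G_c v + Σ_ij vᵢ XP_ij vⱼ` -/
def quadGhatPoly (C : CellData) (v : Fin 3 → ℚ) : SPoly :=
  spNorm (([], ∑ i, ∑ j, v i * C.G i j * v j) ::
    (List.finRange 3).flatMap fun i => (List.finRange 3).flatMap fun j => (XP i j).map fun e => (e.1, v i * e.2 * v j))

/-- `‖Σ vᵢ genᵢ‖² = vᵀ M₀ v` (rational) -/
def normSqGen (v : Fin 3 → ℚ) : ℚ := ∑ i, ∑ j, v i * M0Q i j * v j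

/-- `δ̂ = d_c + x_D` as linear polynomials -/
def dhatPoly (C : CellData) (i : Fin 3) : SPoly := [([], C.dc i), ([vD i], 1)]

/-- `δ̂ᵀ Ĝ δ̂` as a polynomial (cubic) -/
def shiftQuadPoly (C : CellData) : SPoly :=
  spNorm ((List.finRange 3).flatMap fun i => (List.finRange 3).flatMap fun j =>
    spMul (dhatPoly C i) (spMul (([], C.G i j) :: XP i j) (dhatPoly C j)))

/-- negate a polynomial -/
def spNeg (p : SPoly) : SPoly := p.map fun e => (e.1, -e.2)

/-- the polynomial of a window specification -/
def winPoly (C : CellData) : WinSpec → SPoly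
  | .ubrick v p => ucompose p [([v], 1)]
  | .strainLo v => quadGhatPoly C v ++ [([], -((189 / 200) ^ 2 * normSqGen v))]
  | .strainHi v => ([], (199 / 200) ^ 2 * normSqGen v) :: spNeg (quadGhatPoly C v)
  | .shiftWin => ([], 1 / 1600) :: spNeg (shiftQuadPoly C)
  | .mul s t => spMulN (winPoly C s) (winPoly C t)

/-- the check of a window specification against the cell box -/
def winOK (hbox : ℕ → ℚ) : WinSpec → Bool
  | .ubrick v p => decide (1 ≤ v ∧ v ≤ 15) && nonnegOn p (hbox v)
  | .mul s t => winOK hbox s && winOK hbox t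
  | _ => true

/-- raw data of one cell -/
structure CellPack where
  /-- centre data -/
  cd : CellData
  /-- inverse of the centre `Ĝ_c` -/
  Hc : Mat
  /-- box half-widths of the variables `1 … 15` -/
  hbox : ℕ → ℚ
  /-- near-range model data -/
  nd : NearData
  /-- slack -/
  S : Slack
  /-- Gram data -/
  grams : List GramB
  /-- box multipliers (variable, half-width, Gram) -/
  boxes : List (ℕ × ℚ × GramB)
  /-- link multipliers by inter-bond index -/
  links : List (Fin 6 × PolyPF)
  /-- window multipliers by specification -/
  wins : List (WinSpec × GramB)

/-- the link polynomial of inter bond `k`: `rhoPolyGen − x_{10+k}` (vanishes at the chart assignment) -/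
def linkPoly (C : CellData) (k : Fin 6) : SPoly := rhoPolyGen C (interCls k) ++ [([10 + k.val], -1)]

/-- the assembled certificate of a cell -/
def cellCert (ck : CellPack) : CellCert where
  grams := ck.grams
  boxes := ck.boxes
  links := ck.links.map fun l => (linkPoly ck.cd l.1, l.2)
  wins := ck.wins.map fun e => (winPoly ck.cd e.1, e.2)

/-- global parameters of the certificate -/
structure Params where
  /-- the stability constant -/
  κ : ℚ
  /-- `36 Rn²`, `36 Rf²`, `36 R∞²` -/
  qn : ℤ
  /-- `36 Rf²` -/
  qf : ℤ
  /-- the `N0`-constant `K ≥ Σ_{(Rf,R∞]} farCoeff·midP D + 40000/R∞³` -/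
  K : ℚ

/-- the target of a cell -/
def cellTarget (P : Params) (ck : CellPack) : PolyPF :=
  nearPPF ck.cd ck.Hc ck.hbox ck.nd P.qn P.κ ++ chargePPF ck.cd P.qn P.qf ++ farN0PPF P.K

/-- the box list of the FREE variables `1 … 9` -/
def boxList9 (hbox : ℕ → ℚ) : List (ℕ × ℚ) := (List.range 9).map fun i => (i + 1, hbox (i + 1))

/-- the dependent inter-bond variables `10 … 15` stay inside their half-widths on the free box (checked) -/
def interBoxOK (C : CellData) (hbox : ℕ → ℚ) : Bool :=
  (List.finRange 6).all fun k =>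
    spListed (boxList9 hbox) (spNorm (rhoPolyGen C (interCls k))) &&
      decide (spBound (boxList9 hbox) (spNorm (rhoPolyGen C (interCls k))) ≤ hbox (10 + k.val))

/-- **THE CELL CHECK** (one native evaluation per cell). -/
def cellOK (P : Params) (ck : CellPack) : Bool :=
  matEqB (mmul ck.Hc ck.cd.G) oneQ && matEqB (mtrans ck.Hc) ck.Hc && nearChecks ck.cd ck.hbox ck.nd P.qn &&
    interBoxOK ck.cd ck.hbox &&
    (ck.boxes.all fun b => decide (1 ≤ b.1 ∧ b.1 ≤ 15 ∧ ck.hbox b.1 ≤ b.2.1)) &&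
      (ck.wins.all fun e => winOK ck.hbox e.1) &&
        certCheckS (cellTarget P ck) ck.S (boxList ck.hbox) (cellCert ck)

/-- box membership of a single variable. [folklore] -/
theorem abs_le_of_cell (C : CellData) (hbox : ℕ → ℚ) {A B : E3 →L[ℝ] E3} {δ : E3}
    (hcell : ∀ p ∈ boxList hbox, |chartX C A B δ p.1| ≤ (p.2 : ℝ)) {v : ℕ} (hv : 1 ≤ v ∧ v ≤ 15) :
    |chartX C A B δ v| ≤ hbox v := by
  have hmem : (v, hbox v) ∈ boxList hbox := by
    unfold boxList; rw [List.mem_map]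
    refine ⟨v - 1, List.mem_range.mpr (by omega), ?_⟩
    have : v - 1 + 1 = v := by omega
    rw [this]
  exact hcell _ hmem

section WinSound

variable (C : CellData) (hbox : ℕ → ℚ) {A B : E3 →L[ℝ] E3} {δ : E3} (hW : CellWindow A) (hδ : ShiftWindow A δ)
  (hcell : ∀ p ∈ boxList hbox, |chartX C A B δ p.1| ≤ (p.2 : ℝ))

/-- value of `quadGhatPoly`. [folklore] -/
theorem spEval_quadGhatPoly (v : Fin 3 → ℚ) :
    spEval (quadGhatPoly C v) (chartX C A B δ) = ∑ i, ∑ j, (v i : ℝ) * ghat A i j * v j := by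
  unfold quadGhatPoly
  rw [spEval_spNorm, spEval_cons]
  have hflat : ∀ (L : List (Fin 3)) (f : Fin 3 → SPoly) (x : ℕ → ℝ),
      spEval (L.flatMap f) x = (L.map fun i => spEval (f i) x).sum := by
    intro L f x; induction L with
    | nil => rfl
    | cons a rest ih => rw [List.flatMap_cons, spEval_append, ih, List.map_cons, List.sum_cons]
  have hsc : ∀ (i j : Fin 3) (x : ℕ → ℝ), spEval ((XP i j).map fun e => (e.1, v i * e.2 * v j)) x = v i * spEval (XP i j) x * v j := by
    intro i j x
    unfold spEval
    rw [List.map_map]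
    induction XP i j with
    | nil => simp
    | cons e rest ih => simp only [List.map_cons, List.sum_cons, Function.comp_apply] at ih ⊢; rw [ih]; push_cast; ring
  simp only [hflat, ← List.ofFn_eq_map, List.sum_ofFn, hsc, matVal_XP, monoVal, List.map_nil, List.prod_nil, one_mul]
  push_cast
  simp only [← Finset.sum_add_distrib]
  refine Finset.sum_congr rfl fun i _ => Finset.sum_congr rfl fun j _ => ?_
  ring

/-- value of `normSqGen`. [folklore] -/
theorem normSqGen_cast (v : Fin 3 → ℚ) : (normSqGen v : ℝ) = ‖∑ i, (v i : ℝ) • gen i‖ ^ 2 := by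
  rw [norm_sq_combo]; unfold normSqGen; push_cast; simp

/-- value of `dhatPoly`. [folklore] -/
theorem spEval_dhatPoly (i : Fin 3) : spEval (dhatPoly C i) (chartX C A B δ) = contraOf δ i := by
  have e7 : chartX C A B δ 7 = contraOf δ 0 - C.dc 0 := by simp [chartX]
  have e8 : chartX C A B δ 8 = contraOf δ 1 - C.dc 1 := by simp [chartX]
  have e9 : chartX C A B δ 9 = contraOf δ 2 - C.dc 2 := by simp [chartX]
  fin_cases i <;> simp [dhatPoly, vD, spEval, monoVal, e7, e8, e9]

/-- value of `shiftQuadPoly`. [folklore] -/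
theorem spEval_shiftQuadPoly : spEval (shiftQuadPoly C) (chartX C A B δ) = ∑ i, ∑ j, contraOf δ i * ghat A i j * contraOf δ j := by
  unfold shiftQuadPoly
  rw [spEval_spNorm]
  have hflat : ∀ (L : List (Fin 3)) (f : Fin 3 → SPoly) (x : ℕ → ℝ),
      spEval (L.flatMap f) x = (L.map fun i => spEval (f i) x).sum := by
    intro L f x; induction L with
    | nil => rfl
    | cons a rest ih => rw [List.flatMap_cons, spEval_append, ih, List.map_cons, List.sum_cons]
  have h1 : monoVal (chartX C A B δ) [] = 1 := by simp [monoVal]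
  simp only [hflat, ← List.ofFn_eq_map, List.sum_ofFn, spEval_spMul, spEval_cons, matVal_XP, spEval_dhatPoly, h1, one_mul]
  refine Finset.sum_congr rfl fun i _ => Finset.sum_congr rfl fun j _ => ?_
  ring

include hW hδ hcell in
/-- **window polynomials are nonnegative on the cell ∩ window.** -/
theorem winPoly_nonneg (s : WinSpec) (hs : winOK hbox s = true) : 0 ≤ spEval (winPoly C s) (chartX C A B δ) := by
  have hneg : ∀ p : SPoly, spEval (spNeg p) (chartX C A B δ) = -spEval p (chartX C A B δ) := by
    intro p; unfold spEval spNeg; rw [List.map_map]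
    induction p with
    | nil => simp
    | cons e rest ih => simp only [List.map_cons, List.sum_cons, Function.comp_apply] at ih ⊢; rw [ih]; push_cast; ring
  induction s with
  | ubrick v p =>
      simp only [winOK, Bool.and_eq_true, decide_eq_true_eq] at hs
      rw [winPoly, spEval_ucompose]
      refine ueval_nonneg_of_nonnegOn hs.2 ?_
      simpa [spEval, monoVal] using abs_le_of_cell C hbox hcell hs.1
  | strainLo v =>
      rw [winPoly, spEval_append, spEval_quadGhatPoly, spEval_cons, spEval_nil]
      have h := (chart_cellWindow A hW (fun i => (v i : ℝ))).1
      rw [← normSqGen_cast] at h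
      simp [monoVal]
      linarith
  | strainHi v =>
      rw [winPoly, spEval_cons, hneg, spEval_quadGhatPoly]
      have h := (chart_cellWindow A hW (fun i => (v i : ℝ))).2
      rw [← normSqGen_cast] at h
      simp [monoVal]
      linarith
  | shiftWin =>
      rw [winPoly, spEval_cons, hneg, spEval_shiftQuadPoly]
      have h := chart_shiftWindow A δ hδ
      simp [monoVal]
      linarith
  | mul s t ihs iht =>
      simp only [winOK, Bool.and_eq_true] at hs
      rw [winPoly, spEval_spMulN]
      exact mul_nonneg (ihs hs.1) (iht hs.2)

end WinSound

/-- the link polynomials vanish at the chart assignment. [folklore] -/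
theorem spEval_linkPoly (C : CellData) (A B : E3 →L[ℝ] E3) (δ : E3) (k : Fin 6) :
    spEval (linkPoly C k) (chartX C A B δ) = 0 := by
  rw [linkPoly, spEval_append, spEval_rhoPolyGen chartIdentities, spEval_cons, spEval_nil]
  have hx : chartX C A B δ (10 + k.val) = ‖A (bondVec δ (interCls k))‖ ^ 2 - C.rhoc (interCls k) := by
    fin_cases k <;> simp [chartX]
  simp [monoVal, hx]

/-- membership in the full box from membership in the free box and the inter-box check. [folklore] -/
theorem cell_of_cell9 (C : CellData) (hbox : ℕ → ℚ) (hib : interBoxOK C hbox = true) {A B : E3 →L[ℝ] E3} {δ : E3}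
    (hcell9 : ∀ p ∈ boxList9 hbox, |chartX C A B δ p.1| ≤ (p.2 : ℝ)) :
    ∀ p ∈ boxList hbox, |chartX C A B δ p.1| ≤ (p.2 : ℝ) := by
  intro p hp
  unfold boxList at hp
  rw [List.mem_map] at hp
  obtain ⟨i, hi, rfl⟩ := hp
  rw [List.mem_range] at hi
  by_cases h9 : i < 9
  · exact hcell9 (i + 1, hbox (i + 1)) (by unfold boxList9; rw [List.mem_map]; exact ⟨i, List.mem_range.mpr h9, rfl⟩)
  · -- a dependent variable `10 + k`
    obtain ⟨k, hk⟩ : ∃ k : Fin 6, i + 1 = 10 + k.val := ⟨⟨i - 9, by omega⟩, by simp; omega⟩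
    unfold interBoxOK at hib
    rw [List.all_eq_true] at hib
    have h := hib k (List.mem_finRange k)
    simp only [Bool.and_eq_true, decide_eq_true_eq] at h
    obtain ⟨hl, hb⟩ := h
    have hx : chartX C A B δ (10 + k.val) = spEval (rhoPolyGen C (interCls k)) (chartX C A B δ) := by
      rw [spEval_rhoPolyGen chartIdentities]
      fin_cases k <;> simp [chartX]
    have h1 := abs_spEval_le (boxList9 hbox) (chartX C A B δ) hcell9 (spNorm (rhoPolyGen C (interCls k))) hl
    rw [spEval_spNorm] at h1
    simp only
    rw [hk, hx]
    exact h1.trans (by exact_mod_cast hb)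

/-- **SOUNDNESS OF A CELL:** a passing cell check gives the `NearCertificate` inequality for every window datum in
the cell, with the chain charges on `(Rn, Rf]` and the `N0`-charge `K`. -/
theorem cell_sound (hC : ChainBound) {P : Params} {ck : CellPack} (hok : cellOK P ck = true) (hκ : 0 ≤ P.κ)
    {Rn Rf : ℝ} {bn bf : ℕ} (hbn : ⌈2 * Rn⌉₊ + 1 = bn) (hqn : ((P.qn : ℤ) : ℝ) = 36 * Rn ^ 2)
    (hbf : ⌈2 * Rf⌉₊ + 1 = bf) (hqf : ((P.qf : ℤ) : ℝ) = 36 * Rf ^ 2) (hRn : 2 ≤ Rn) (hRf : 0 ≤ Rf)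
    (hvalid : ValidChains Rn Rf chainNN) (hnn : chainsNN P.qn P.qf = true)
    {A B : E3 →L[ℝ] E3} {δ : E3} (hW : CellWindow A) (hδ : ShiftWindow A δ) (hAB : Contragredient A B)
    (hcell9 : ∀ p ∈ boxList9 ck.hbox, |chartX ck.cd A B δ p.1| ≤ (p.2 : ℝ)) {w : Label → E3} (hw : (support w).Finite) :
    2 * P.κ * (∑ c ∈ nnClasses, metricForm B c w) + chargeSum Rn Rf chainNN A δ w + P.K * N0 w ≤
      ∑ c ∈ classesR Rn, classTerm A B δ w c := by
  unfold cellOK at hok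
  simp only [Bool.and_eq_true, List.all_eq_true, decide_eq_true_eq] at hok
  obtain ⟨⟨⟨⟨⟨⟨hinv, hsym⟩, hnear⟩, hib⟩, hboxes⟩, hwins⟩, hcert⟩ := hok
  have hcell := cell_of_cell9 ck.cd ck.hbox hib hcell9
  set x := chartX ck.cd A B δ
  -- the certificate: 0 ≤ target
  have h0 : 0 ≤ evalPPF (cellTarget P ck) x w := by
    refine certCheckS_sound hcert x (fun b hb => ?_) hcell (fun l hl => ?_) (fun e he => ?_) hw
    · obtain ⟨hb1, hb2, hb3⟩ := hboxes b hb
      exact (abs_le_of_cell ck.cd ck.hbox hcell ⟨hb1, hb2⟩).trans (by exact_mod_cast hb3)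
    · simp only [cellCert, List.mem_map] at hl
      obtain ⟨l', -, rfl⟩ := hl
      exact spEval_linkPoly ck.cd A B δ l'.1
    · simp only [cellCert, List.mem_map] at he
      obtain ⟨e', he', rfl⟩ := he
      exact winPoly_nonneg ck.cd ck.hbox hW hδ hcell e'.1 (hwins e' he')
  -- the target is below the true finite-range form minus the charges
  have hRn0 : 0 ≤ Rn := by linarith
  have h1 := near_le ck.cd ck.Hc ck.hbox ck.nd hW hδ hAB hinv hsym hcell hw hbn hqn hRn0 hκ hnear
  have h2 := charge_le hC hbn hqn hbf hqf hRn hRf hvalid hnn ck.cd (B := B) hW hδ hw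
  have h3 := evalPPF_farN0PPF P.K x hw
  unfold cellTarget at h0
  rw [evalPPF_append, evalPPF_append, h3] at h0
  linarith

/-- the chain-validity check over the range -/
def validChainsB (qn qf : ℤ) : Bool :=
  (classRange qn qf).all fun c => decide (IsChain c (chainNN c)) && (chainNN c).all fun s => decide (¬ diagClass s)

/-- `ValidChains` from the check. [folklore] -/
theorem validChains_of_check {Rn Rf : ℝ} {bn bf : ℕ} {qn qf : ℤ} (hbn : ⌈2 * Rn⌉₊ + 1 = bn)
    (hqn : ((qn : ℤ) : ℝ) = 36 * Rn ^ 2) (hbf : ⌈2 * Rf⌉₊ + 1 = bf) (hqf : ((qf : ℤ) : ℝ) = 36 * Rf ^ 2)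
    (hRn : 0 ≤ Rn) (hRf : 0 ≤ Rf) (h : validChainsB qn qf = true) : ValidChains Rn Rf chainNN := by
  intro c hc
  rw [farClasses_eq_toFinset hbn hqn hbf hqf hRn hRf, List.mem_toFinset] at hc
  unfold validChainsB at h
  rw [List.all_eq_true] at h
  have h1 := h c hc
  simp only [Bool.and_eq_true, decide_eq_true_eq, List.all_eq_true] at h1
  exact ⟨h1.1, fun s hs => h1.2 s hs⟩

/-- **`NearCertificate` from finitely many sound cells.**  Parameters: `Rn, Rf` reals with `36Rn² = qn`,
`36Rf² = qf`, `R∞ ≥ 100` with `36R∞² = qi`, denominators `D`, and `K ≥ (sumRange (midCeil D) qf qi)/D + 40000/R∞³`. -/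
theorem nearCertificate_of_cells (hC : ChainBound) (hP : PathBound) (P : Params) (cells : List CellPack)
    (hok : cells.all (cellOK P) = true) (hκ : 0 < P.κ)
    {Rn Rf Rinf : ℝ} {bn bf bi : ℕ} {qi : ℤ} (hbn : ⌈2 * Rn⌉₊ + 1 = bn) (hqn : ((P.qn : ℤ) : ℝ) = 36 * Rn ^ 2)
    (hbf : ⌈2 * Rf⌉₊ + 1 = bf) (hqf : ((P.qf : ℤ) : ℝ) = 36 * Rf ^ 2) (hbi : ⌈2 * Rinf⌉₊ + 1 = bi)
    (hqi : ((qi : ℤ) : ℝ) = 36 * Rinf ^ 2) (hRn : 2 ≤ Rn) (hRnf : Rn ≤ Rf) (hRfi : Rf ≤ Rinf) (hRinf : 100 ≤ Rinf)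
    (hvalid : validChainsB P.qn P.qf = true) (hnn : chainsNN P.qn P.qf = true) {D : ℕ} (hD : 0 < D)
    (hK : ((sumRange (fun c => (midCeil D c : ℚ)) P.qf qi : ℚ) : ℝ) / D + 40000 / Rinf ^ 3 ≤ P.K)
    (hcover : ∀ (A B : E3 →L[ℝ] E3) (δ : E3), CellWindow A → ShiftWindow A δ →
      ∃ ck ∈ cells, ∀ p ∈ boxList9 ck.hbox, |chartX ck.cd A B δ p.1| ≤ (p.2 : ℝ)) :
    NearCertificate := by
  have hRf : 0 ≤ Rf := by linarith
  have hRinf0 : 0 ≤ Rinf := by linarith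
  refine ⟨P.κ, by exact_mod_cast hκ, Rn, Rf, Rinf, chainNN, midP D, hRn, hRnf, hRfi, hRinf,
    validChains_of_check hbn hqn hbf hqf (by linarith) hRf hvalid, midBound_midP hC hP hRf hD, ?_⟩
  intro A B δ w hW hδ hAB hw
  obtain ⟨ck, hck, hcell⟩ := hcover A B δ hW hδ
  rw [List.all_eq_true] at hok
  have hs := cell_sound hC (hok ck hck) hκ.le hbn hqn hbf hqf hRn hRf
    (validChains_of_check hbn hqn hbf hqf (by linarith) hRf hvalid) hnn hW hδ hAB hcell hw
  have hmid := sum_farCoeff_midP_eq hbf hqf hbi hqi hRf hRinf0 hD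
  have hN0 : 0 ≤ N0 w := Finset.sum_nonneg fun c _ => tsum_nonneg fun _ => by positivity
  have hKN : (∑ c ∈ farClasses Rf Rinf, farCoeff c * midP D c) * N0 w + 40000 / Rinf ^ 3 * N0 w ≤ P.K * N0 w := by
    rw [hmid, ← add_mul]
    exact mul_le_mul_of_nonneg_right hK hN0
  linarith

/-- Anchor of this support file (registered stub of the line skeleton, lead c2). -/
theorem stub_certAssembly : ∀ (C : CellData) (A B : EuclideanSpace ℝ (Fin 3) →L[ℝ] EuclideanSpace ℝ (Fin 3)) (δ : EuclideanSpace ℝ (Fin 3)) (k : Fin 6),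
    spEval (rhoPolyGen C (interCls k) ++ [([10 + k.val], -1)]) (chartX C A B δ) = 0 :=
  fun C A B δ k => spEval_linkPoly C A B δ k

end Summit.AtomisticToContinuum.Crystallization.Theorems.PhononStabilityCWC.Cert

end
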